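import Literature.AlgebraicGeometry.HodgeTheory.SecantQuotientJacobianTwistedCarrier
import Literature.AlgebraicGeometry.HodgeTheory.TwistedPerfectAdmissibilityInitialSegment
import Summits.Ventures.HSemireg.AmplificationChainAssembly
import Summits.Ventures.HSemireg.AmplificationChainSigmaGluable
import Summits.HodgeConjecture.HodgeConjecture.Theses.EightfoldTwistedSheafSeeds
import Literature.AlgebraicGeometry.Motives.FourTranslatesMeet
import HarnessLib

/-!
# SheafSeedGaussSq · LINE `secant-q824` — TREE-ANCHORED BIRTH SKELETON (BC3) with a TYPED plan-only BC5 rung (bc5-plan g20, v5)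

v5 (2026-08-30 ≈10:30Z, bc5-plan g20) = v4 (sha16 b0f645abe3ceee68, the REGISTERED skeleton of stmt-HodgeConjecture-30548 since
09:18:48Z) with the ONE misstated datum field REPAIRED. The standing disprover `cdisprove-stmt-HodgeConjecture-30548` g0 showed
(VERDICT 2026-08-30T09:24:53Z; `Cruxes/SheafSeedGaussSq/Disproof.lean` §A; landed p767843
`Theorems/SheafSeedGaussSq/Negative/SecantTranslatesGeneralPosition.lean`, modulo the accepted named fact p767842
`Literature.AlgebraicGeometry.Motives.FourTranslatesMeet`) that v1–v4's field
`generalPosition : TranslatesInGeneralPosition 𝒥.J Θ (sumSet G₁ G₂)` — Markman's THREEFOLD general position (any FOUR pairwise-distinct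
translates of `Θ` DISJOINT, any three finite; `Literature.AlgebraicGeometry.Markman2025.SecantQuotientCarrier`, copied verbatim from the
genus-3 `SecantQuotientDatum`) — is unsatisfiable on the abelian FOURFOLD `J` (four translates of an effective ample divisor on a fourfold
always meet; `(Θ⁴) = 4! = 24`): modulo `FourTranslatesMeet` the v4 datum type is EMPTY, v4's STUB 1 is false at every `C` and v4's STUB 2
holds vacuously. v5 re-types the field in the dimension-correct form the disprover prescribed («FIVE translates disjoint ∧ FOUR finite»):
`generalPosition : TranslatesInGeneralPositionN 4 𝒥.J Θ (sumSet G₁ G₂)` with the line-local, dimension-parametric predicate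
`TranslatesInGeneralPositionN n` = «any `n+1` pairwise-distinct translates have EMPTY intersection ∧ any `n` pairwise-distinct translates
have FINITE intersection» (`n = 3` is the Literature predicate up to the indexing of the points; `n = 4 = dim J` here) — exactly what
Markman's proof of Lemma 9.3.1 establishes one dimension up (degenerate to a chain of four elliptic curves: `Θ = ⋃ Dᵢ`, each `Dᵢ`
disjoint from its non-trivial translates, so five translates never meet and four meet in the `4! = 24` points `⋂ₖ τ_{sₖ}D_{σ(k)}`,
`σ ∈ S₄`; «the property is open in moduli» — heuristic at the level of the printed genus-3 lemma, see the card `Lines/secant-q824.md`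
v1.3 §R). At the rung `j = 1` (`#G₁G₂ = 4`) the five-clause is VACUOUS (`GenusFourSecantDatum.emptyClause_levelOne`, sorry-free: a set of
at most `2·2` elements has no five pairwise-distinct members) and the four-clause is ONE condition, «`τ_0Θ ∩ τ_{g₁}Θ ∩ τ_{g₂}Θ ∩ τ_{g₁+g₂}Θ`
finite», whose intersection is NONEMPTY modulo `FourTranslatesMeet` (`GenusFourSecantDatum.fourTranslates_nonempty`, sorry-free) — so the
repaired clause asks FINITENESS, never emptiness, and the Negative lemma p767843 no longer has a field to bite on. Everything else is
byte-identical to v4: the stub NAMES `stub_rung_secantObjectsQ824` / `stub_transfer_secantQuotientEightfold` and their signature TEXT are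
unchanged (their MEANING changes through the datum type; the registration sha discriminates v4 from v5), `SheafSeedGaussSq_of` is the one
hypothesis-free theorem concluding the crux. WHERE §9 CONSUMES general position in genus 3 and why its `n = 4` consumer is not in print:
Assumption 9.2.1 (1) bounds, for each `x ∈ X`, the number of surfaces `Θ_{i,j} = Σ_j − C_i ∋ x` (translates of `W₂ = Θ`, `dim X = 3`) by
three, which bounds the chains of `Z_red = ⋃ C_i ∪ ⋃ τ_{−x}Σ_j` in the proof of Prop. 9.2.2 (reflexivity / local freeness of the
secant^{⊠2} sheaf off `Θ̃`); in genus 4 with Markman's `W₂`-translates (Question 8.2.4) the meeting locus `Σ_j − Z_i` is a translate of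
`−W₄ = J`, so the `n = 4` local analysis must be re-derived — the field is carried as the typable genericity of `(J, Θ, G₁, G₂)` that
Lemma 9.3.1 provides; its `n = 4` consumer belongs to STUB 2's open content (card §R, STUB 2 «why it might fail», sharpened: at `j = 1`,
`d = 1 < 3` is outside the proved range `d ≥ 3` of the genus-3 model's Assumption 9.1.1, Lemma 9.1.2 / 9.1.4).
[cite: Markman2025SecantWeil, §8.2 Ex. 8.2.3 and Question 8.2.4, §9.1 Lemma 9.1.2 and Lemma 9.1.4, §9.2 Assumption 9.2.1 and Prop. 9.2.2, §9.3 Lemma 9.3.1]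
[cite: Hartshorne1977, I Thm. 7.2 and II Thm. 7.6] [cite: MumfordAV1970, §6 Application 1 and §16]

v4 (2026-08-30 ≈09:00Z, bc5-plan g19) = v3 (sha16 1a65404623c984a4) made to PASS the gate's skeleton lint `#h21_check_skeleton`
(`ledger skeleton check … --crux stmt-HodgeConjecture-30548`; source `HarnessLib/Audit/Check.lean` `checkSkeletonCore` + `analyseGlue`):
the lint takes the FIRST theorem (environment order) whose conclusion head is the crux decl and requires each of its `Prop` hypotheses
to have as HEAD CONSTANT a tagged route-item decl or a declared stub NAME — a hypothesis of shape `∀ C, …` or `(h : GenusFourSecantSeed)`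
has no such head and is `skeleton.extra-hypothesis` (v3 failed exactly so in bc5-plan g19's pre-flight, as did the tree's
`Cruxes/SheafSeedGaussSq/Lines/birth.lean` v1 on `SheafSeedGaussSq_of (hR : ∀ C, …)`). v4 therefore has EXACTLY ONE theorem concluding
the crux, `SheafSeedGaussSq_of`, and it is HYPOTHESIS-FREE: it invokes the two sorried `stub_*` theorems directly (the accepted shape of
№3's registered `BlochSeedDiscOne_of_pad4`, `Cruxes/BlochSeedDiscOne/Lines/birth.lean` 814a6a70c14e831a). The stub-statements-as-hypotheses
composition survives as the two sorry-free glue lemmas `genusFourSecantSeed_of` (STUB 1 statement → STUB 2 statement → pinned form) and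
`hasHyperbolicSeedOn_four_four_of_genusFourSecantSeed` (pinned form → the level-(4, 2²) seed for every `C`), whose conclusions are NOT the
crux decl, so the lint sees one candidate only. Stub names and signatures are byte-identical to v1–v3 (probes 9cea67c0e21a2ce6 and the BC7
runs 9596169884fb3088 / ea7880a4a8df9522 stand). `lean check`: rc 0, sorries 2 (the stubs); pre-flight `#h21_check_skeleton`: ok = true,
codes [], theorem = `…SecantQ824.SheafSeedGaussSq_of`, closed = false (stubs open).

v3 (2026-08-30 ≈08:25Z) = skeleton v2 (sha16 a241774828ff9389) RE-ANCHORED on the BORN sibling route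
`route-HodgeConjecture-EightfoldTwistedSheafSeeds` (born 2026-08-30T07:54:23Z DRAFT, rev 0 commit 9e029175fdea; crux item
stmt-HodgeConjecture-30548): the local `def SheafSeedGaussSq` of v1/v2 is GONE and every concluding theorem now concludes the ROUTE DECL
`Summit.HodgeConjecture.HodgeConjecture.Theses.EightfoldTwistedSheafSeeds.SheafSeedGaussSq` BY NAME (its text is byte-identical to the
v1/v2 local def = bc5-plan g17 `SheafDoorSpec.lean` §8). Namespace `…Cruxes.SheafSeedGaussSq.SecantQ824`, i.e. this file is ready to be
written as `Cruxes/SheafSeedGaussSq/Lines/secant-q824.lean` by whoever holds crux-write on 30548 (REQUESTS l.59637 req-110 (B)) and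
registered with `ledger skeleton check … --crux stmt-HodgeConjecture-30548`. The two stubs and their signatures are unchanged from v1.


Cell work file of `pub-hsemireg/hodge-bloch-bc5-plan` (seat bc5-plan g18) for the SIBLING sheaf route of
`route-HodgeConjecture-EightfoldBlochSeeds` (req-108 seat `plancard-HodgeConjecture-SheafSeedGaussSq`): the registered-stub
skeleton the route-level seat publishes as `Cruxes/SheafSeedGaussSq/Lines/birth.lean` right after `route open`
(planner.md 4b BC3), and the exact Lean signature of the PLAN-ONLY BC5 rung (4b BC5, `T3-plan-only`). Nothing here is
filed; §0 `SheafSeedGaussSq` is the PROPOSED CRUX TEXT verbatim (bc5-plan g17 `SheafDoorSpec.lean` §8) — at filing the seat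
replaces the local `def` by the route decl `Summit.HodgeConjecture.HodgeConjecture.Theses.<Slug>.SheafSeedGaussSq` (same
term) and re-runs `lean check`. `sorry` occurs ONLY inside the two `stub_*` theorems; the composition
`SheafSeedGaussSq_of` is kernel-checked.

## The line (Markman's genus-4 secant programme, typed over existing declarations)

INPUT (`GenusFourSecantDatum`): a smooth projective curve `C` with a Jacobian `𝒥` of dimension `4`, a Riemann theta divisor
`Θ` which is a principal polarization divisor, a level `j ≥ 1` (Markman's `d = j²`, so `K = ℚ(√-d) = ℚ(i)` — the route's
corner), two cyclic subgroups `G₁, G₂ ≤ J[j²+1](ℂ)` of order `j²+1` meeting trivially, Lemma 9.3.1's general position.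
From it the tree BUILDS (F4 `Literature.AlgebraicGeometry.Markman2025.SecantQuotientCarrier`): `P = J × Ĵ` (dim `8`),
`φ = φ_{j²}` with `φ² = -j²`, the secant quotient `Y = (J × Ĵ)/Ḡ` (an abelian EIGHTFOLD) with its isogeny `q`, and the two
quotient FOURFOLDS `Y₁ = J/G₁`, `Y₂ = J/G₂` (`torsionQuot`) with their isogenies `π₁, π₂`.

* STUB 1 = THE BC5 RUNG (plan-only) `stub_rung_secantObjectsQ824` — **Markman's Question 8.2.4, typed**: at `j = 1`
  (`d = 1`, `|G| = 2`) each quotient fourfold `J/Gᵢ` carries a `B`-twisted `AdmTw'`-ADMISSIBLE perfect complex (σ of the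
  complex injective on `Ext²`, `Ext^{<0} = 0`, all degrees `≤ 4` in `I`) of non-zero rank whose twisted classes, pulled back
  to `J`, lie on the SECANT PLANE `span(Re, Im/√d) exp(√-d·θ₀)` of a polarization class `θ₀` of `Θ`
  (`HasSecantTwistedObjectOn`; Markman's candidate: the `G`-invariant partial normalisation `F̄′ = [𝒪_Y → ν̄_*𝒪_{Z̃/G}]` of
  the secant ideal sheaf `I_Z(Θ)`, `ch = 1 + Θ − (d/2)Θ² − (d/6)Θ³ + (d²/24)Θ⁴`, Ex. 8.2.3). Named technique: Markman's
  genus-3 method — Lemma 8.3.4 (criterion: `ker ob_E = ker(⌟ch(E))` in `HT²` and `ob_E` surjective ⟹ semiregular) fed by a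
  Lemma 8.3.7-type computation (Yoneda algebra generated in degree `1`, `ev_E` surjective with kernel `ann ch(E)`), Cor. 8.5.4.
* STUB 2 = THE TRANSFER `stub_transfer_secantQuotientEightfold` — the `n = 4` analogue of Markman §9 (survey Prop. 11.1,
  11.5): secant objects on both quotient fourfolds ⟹ ONE `B`-twisted admissible seed on the secant-quotient EIGHTFOLD `Y` for
  the descended operator `ψ_Y` (`q ≫ ψ_Y = ((j²+1)·φ) ≫ q`, `ψ_Y² = -((j²+1)j)²`), i.e. `D.HasTwistedSeed` (= the binders of
  `HasHyperbolicSeedOn … 4 m²`, `m = (j²+1)j`, with `P` PINNED to `Y`).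
* COMPOSITION `SheafSeedGaussSq_of` (no `sorry`): rung at `j = 1` + transfer ⟹ `HasHyperbolicSeedOn … 4 4` for every `C`
  ⟹ `SheafSeedGaussSq` with `m = 2`. The intermediate statement `GenusFourSecantSeed` (the crux PINNED to Markman's named
  `n = 4` anchor family — the shape of №3's accepted plan-only rung `stub_rung_pad4_seedAt`) is recorded with both glue lemmas.

Why the rung is NOT inside `S`'s known regime (BC5 why-clause): it asserts the admissibility (semiregularity) of ONE explicit
fourfold-level object and says nothing about Weil classes; `S = WeilSixfolds` neither implies nor is implied by it; it is
Markman's own stated open question (Question 8.2.4: «Is the object F̄′ semiregular … ?»), one level BELOW the eightfold seed,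
and it exercises exactly the route's lever (twisted-semiregular objects with classes off the divisor ring: `κ₂ = -(d/2)·rank·θ²`
has the WRONG SIGN for every direct sum of line bundles, Lefschetz-injectivity of `∪θ`, `∪θ²` on `H^{0,2}` kills split
complexes with `≥ 4` distinct summands — see the memo's degenerate-witness pass).

References: [cite: Markman2025SecantWeil, §1.5, Ex. 8.2.3, Question 8.2.4, Ex. 8.2.5, Lemma 8.3.4, Lemma 8.3.7, Cor. 8.5.4,
§9.3 Lemma 9.3.1 and Lemma 9.3.3] [cite: Markman2025SurveySecant, Prop. 11.1, Prop. 11.5, Question 11.4 and §12]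
[cite: BuchweitzFlenner2003, Def. 4.1, §5 Thm. 5.1] [cite: Pridham2024Semiregularity, Cor. 2.25 and Rem. 2.26]
[cite: vanGeemen1994HodgeAV, 5.2–5.4] [cite: MumfordAV1970, §7 Thm. 4 p. 72].
v2 (2026-08-30 ≈08:00Z): `GenusFourSecantDatum` gains the genericity field `endQ : Module.finrank ℚ 𝒥.J.endAlgebra = 1`
(`End⁰(J) = ℚ`, Ex. 8.2.3's «Brill–Noether generic `C`»), which removes the special-Jacobian junk window of STUB 1 (memo v1.1 §3);
nothing else changed (v1 sha16 c41a4b01e76537f4).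
-/

noncomputable section

open CategoryTheory AlgebraicGeometry

namespace Summit.HodgeConjecture.HodgeConjecture.Cruxes.SheafSeedGaussSq.SecantQ824

-- the cell's namespace repeats the summit name, as in every crux work file
set_option linter.dupNamespace false

open Literature.AlgebraicGeometry Literature.AlgebraicGeometry.Motives Literature.AlgebraicGeometry.Motives.AbelianVariety
open Literature.AlgebraicGeometry.HodgeTheory Literature.AlgebraicGeometry.Markman2025
open Literature.AlgebraicTopology.SingularHomology
open Summit.Ventures.HSemireg
open scoped Pointwise

/-! ## §0 The admissibility notion and the crux text (verbatim bc5-plan g17 `SheafDoorSpec.lean` §1, §8) -/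

/-- `AdmTw'` — the primed twisted admissibility of item stmt-HodgeConjecture-20706 (`gluableSigmaAdmissible ∨ bfSingleAdmissible'`).
A reducible abbreviation ONLY for this file. [cite: BuchweitzFlenner2003, Def. 4.1 and §5] [cite: Pridham2024Semiregularity, Cor. 2.25 and Rem. 2.26] -/
abbrev AdmTwP : PerfectAdmissibility := fun n X₀ I E =>
  Summit.Ventures.HSemireg.gluableSigmaAdmissible n X₀ I E ∨
    Literature.AlgebraicGeometry.HodgeTheory.bfSingleAdmissible' n X₀ I E

/- **THE CRUX** is the route decl `Summit.HodgeConjecture.HodgeConjecture.Theses.EightfoldTwistedSheafSeeds.SheafSeedGaussSq`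
(item stmt-HodgeConjecture-30548): `∃ m : ℕ, 0 < m ∧ ∀ C : ChernCharacterBetti, HasHyperbolicSeedOn (twistedReflexiveClass C AdmTw') 4 (m ^ 2)`
with `AdmTw' = gluableSigmaAdmissible ∨ bfSingleAdmissible'` (= `AdmTwP` below, the same lambda term). No local copy is declared in v3. -/

/-! ## §1 The secant plane of `exp(√-d·θ)` and secant objects on a quotient fourfold -/

/-- Degree-`p` coefficient of the REAL part of `exp(√-d·θ)`: `[p even]·(-d)^{p/2}/p!` (`1, 0, -d/2, 0, d²/24, …`).
[cite: Markman2025SecantWeil, Ex. 8.2.3 (the classes α, β)] -/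
def secRe (d p : ℕ) : ℚ := if Even p then (-(d : ℚ)) ^ (p / 2) / (p.factorial : ℚ) else 0

/-- Degree-`p` coefficient of `Im exp(√-d·θ)/√d`: `[p odd]·(-d)^{(p-1)/2}/p!` (`0, 1, 0, -d/6, 0, …`).
[cite: Markman2025SecantWeil, Ex. 8.2.3 (the classes α, β)] -/
def secIm (d p : ℕ) : ℚ := if Even p then 0 else (-(d : ℚ)) ^ (p / 2) / (p.factorial : ℚ)

/-- **A SECANT TWISTED OBJECT on the quotient `B` of the abelian fourfold `A` along `π : A → B`, for `θ ∈ H²(A)` at discriminant `d`**: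
a `B`-twisted `Adm`-admissible strictly perfect complex on `B` (the tree's `twistedReflexiveClass C Adm 4 B.X I κ`: `κ = exp(B₀)·ch(E•)`,
`B₀` rational algebraic, `Adm 4 B.X I E•`) with every degree `p ≤ 4` in `I`, NON-ZERO RANK `x`, and twisted classes pulled back to `A`
on the secant plane: `π^*κ_p = (x·secRe d p + y·secIm d p)·θᵖ`, i.e. `π^*κ = x·Re exp(√-d θ) + y·Im exp(√-d θ)/√d`. Markman's `F̄′`
on `X/G` (Question 8.2.4) is the intended witness with `(x, y) = (1, 1)`: `q^*ch(F̄′) = ch(F′) = 1 + Θ − (d/2)Θ² − (d/6)Θ³ + (d²/24)Θ⁴`.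
[cite: Markman2025SecantWeil, Ex. 8.2.3 and Question 8.2.4] [cite: BuchweitzFlenner2003, §5 (I-semiregular)] -/
def HasSecantTwistedObjectOn (C : ChernCharacterBetti) (Adm : PerfectAdmissibility) (d : ℕ) (A B : AbelianVariety ℂ)
    (π : A ⟶ B) (θ : complexBetti A.X 2) : Prop :=
  ∃ (I : Finset ℕ) (κ : (p : ℕ) → complexBetti B.X (2 * p)) (x y : ℚ),
    (∀ p : ℕ, p ≤ 4 → p ∈ I) ∧ twistedReflexiveClass C Adm 4 B.X I κ ∧ x ≠ 0 ∧
    ∀ p ∈ I, complexBetti.map π.hom.hom.hom (2 * p) (κ p) = ((x * secRe d p + y * secIm d p : ℚ) : ℂ) • cupPowTwo θ p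

/-! ## §2 Markman's genus-4 input datum and the objects F4 builds from it -/

/-- **The translates `τ_s(Θ)`, `s ∈ S`, are in general position IN DIMENSION `n`** (v5; the dimension-parametric form of
`Literature.AlgebraicGeometry.Markman2025.TranslatesInGeneralPosition`, which is the case `n = 3` written with explicit binders): any
`n + 1` pairwise-distinct translates of `Supp Θ` by points of `S` have EMPTY intersection, and any `n` pairwise-distinct translates have
FINITE intersection. For `n = dim A` this is what Markman's proof of Lemma 9.3.1 establishes (there `n = 3`: «the intersection of any
four translates is empty and any three translates have finite intersection»); for `n = 3 < dim A = 4` the first clause is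
unsatisfiable as soon as `S` has four elements (`Literature.AlgebraicGeometry.Motives.FourTranslatesMeet`, p767842; the disprover's
finding p767843) — the v1–v4 misstatement this predicate repairs. A line-local definition ONLY (no Literature duplicate: `lean search
'GeneralPosition'` finds the `n = 3` predicate alone); its instance `n = 4` is — binder for binder, up to `4 + 1 = 5` — the standing
disprover's typed repair `Cruxes.SheafSeedGaussSq.Disproof.TranslatesInGeneralPosition₄` (`Disproof.lean` §A′, which imports THIS
module and so cannot be imported here), so `D.generalPosition` is usable verbatim where `TranslatesInGeneralPosition₄ D.𝒥.J D.Θ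
(sumSet D.G₁ D.G₂)` is expected. [cite: Markman2025SecantWeil, §9.3 Lemma 9.3.1 (proof) and §9.2 Assumption 9.2.1 (1)] -/
def TranslatesInGeneralPositionN (n : ℕ) (A : AbelianVariety ℂ) (Θ : CartierDivisor A.X.left) (S : Set (A.Points ℂ)) : Prop :=
  (∀ s : Fin (n + 1) → A.Points ℂ, (∀ i, s i ∈ S) → Function.Injective s → ⋂ i, thetaTranslate A Θ (s i) = ∅) ∧
  (∀ s : Fin n → A.Points ℂ, (∀ i, s i ∈ S) → Function.Injective s → (⋂ i, thetaTranslate A Θ (s i)).Finite)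

/-- `G₁G₂ = ↑G₁ * ↑G₂`, the pointwise product of the underlying sets. [folklore] -/
theorem sumSet_eq_mul {A : AbelianVariety ℂ} (G₁ G₂ : Subgroup (A.Points ℂ)) :
    sumSet G₁ G₂ = (G₁ : Set (A.Points ℂ)) * (G₂ : Set (A.Points ℂ)) := by
  ext s
  simp only [sumSet, Set.mem_setOf_eq, Set.mem_mul, SetLike.mem_coe]
  constructor
  · rintro ⟨g₁, h₁, g₂, h₂, rfl⟩
    exact ⟨g₁, h₁, g₂, h₂, rfl⟩
  · rintro ⟨g₁, h₁, g₂, h₂, rfl⟩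
    exact ⟨g₁, h₁, g₂, h₂, rfl⟩

/-- `#(G₁G₂) ≤ #G₁ · #G₂` (as `Set.ncard` / `Nat.card`). [folklore] -/
theorem ncard_sumSet_le {A : AbelianVariety ℂ} (G₁ G₂ : Subgroup (A.Points ℂ)) :
    (sumSet G₁ G₂).ncard ≤ Nat.card G₁ * Nat.card G₂ := by
  rw [sumSet_eq_mul, ← Nat.card_coe_set_eq]
  exact Set.natCard_mul_le

/-- **A five-clause over a set of at most four points is vacuous**: no injective `t : Fin 5 → S` when `S` is finite with
`S.ncard ≤ 4`. [folklore] -/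
theorem no_five_injective_of_ncard_le_four {α : Type*} {S : Set α} (hS : S.Finite) (h4 : S.ncard ≤ 4) (t : Fin 5 → α)
    (hmem : ∀ i, t i ∈ S) (ht : Function.Injective t) : False := by
  have h5 : (Set.range t).ncard = 5 := by
    rw [Set.ncard_range_of_injective ht]
    simp
  have hsub : Set.range t ⊆ S := by
    rintro _ ⟨i, rfl⟩
    exact hmem i
  have := Set.ncard_le_ncard hsub hS
  omega

/-- **A GENUS-4 SECANT–QUOTIENT DATUM** — the input of Markman's construction in dimension `n = 4` at level `d = j²` (so that
`K = ℚ(√-d) = ℚ(i)`): a smooth projective complex curve `C`, a Jacobian `𝒥` of `C` of dimension `4`, a Riemann theta divisor `Θ`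
of `𝒥` which is a principal polarization divisor, `j ≥ 1`, cyclic subgroups `G₁, G₂ ≤ J[j²+1](ℂ)` of order `j²+1` meeting trivially,
and the DIMENSION-4 general position of the translates `τ_s(Θ)`, `s ∈ G₁ + G₂` (`TranslatesInGeneralPositionN 4`, v5). The genus-3
`SecantQuotientDatum` of the road with `dim J = 4`, the level parametrised as a square, and Lemma 9.3.1's general position taken ONE
DIMENSION UP («Brill–Noether general `C` of genus 4» of Ex. 8.2.3 is NOT a field).
[cite: Markman2025SecantWeil, §1.5 (p. 7), Ex. 8.2.3, §9.3 Lemma 9.3.1 and Lemma 9.3.3] -/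
structure GenusFourSecantDatum where
  /-- the square root of the level: `d = j²`. -/
  j : ℕ
  /-- `j ≥ 1`. -/
  j_pos : 0 < j
  /-- the curve `C`. -/
  C : SchemeOver ℂ
  /-- `C` is a smooth projective curve. -/
  smooth : IsSmoothProjective 1 C
  /-- a Jacobian of `C`. -/
  𝒥 : Jacobian C
  /-- genus `4`: `dim J(C) = 4`. -/
  dim_J : 𝒥.J.dim = 4
  /-- genericity — Ex. 8.2.3's «Brill–Noether generic curve `C`» in its typable form **`End⁰(J(C)) = ℚ`** (very general `C`;
  hence `NS(J)_ℚ = ℚ·θ` and the same for the isogenous quotients `J/Gᵢ`). It closes the special-Jacobian junk window of the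
  plan-only rung: with `NS_ℚ = ℚθ` NO direct sum of shifted line bundles has twisted classes on the secant plane with
  `x ≠ 0` AND a jointly injective `σ` (memo v1.1 §3: Vandermonde in the slopes forces `≥ 4` distinct slopes, `σ` of a split
  complex sees only diagonal blocks and maps `6k` dimensions into `≤ 18`). [cite: Markman2025SecantWeil, Ex. 8.2.3]
  [cite: MumfordAV1970, §19 (the structure of End⁰(X)) and §21 (application: NS ⊗ ℚ ⊆ End⁰)] -/
  endQ : Module.finrank ℚ 𝒥.J.endAlgebra = 1
  /-- the theta divisor. -/
  Θ : CartierDivisor 𝒥.J.X.left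
  /-- `Θ` is a Riemann theta divisor of `𝒥` (a translate of `W₃`). -/
  riemann : 𝒥.IsRiemannThetaDivisor Θ
  /-- `Θ` is a principal polarization divisor (`Θ` ample, `K(Θ) = 0`). -/
  principal : 𝒥.J.IsPrincipalPolarizationDivisor Θ
  /-- the first cyclic subgroup `G₁ ≤ J[j²+1](ℂ)`. -/
  G₁ : Subgroup (𝒥.J.Points ℂ)
  /-- the second cyclic subgroup `G₂ ≤ J[j²+1](ℂ)`. -/
  G₂ : Subgroup (𝒥.J.Points ℂ)
  /-- `G₁ ≤ J[j²+1](ℂ)`. -/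
  G₁_le : G₁ ≤ 𝒥.J.torsionPoints ℂ (j ^ 2 + 1 : ℕ)
  /-- `G₂ ≤ J[j²+1](ℂ)`. -/
  G₂_le : G₂ ≤ 𝒥.J.torsionPoints ℂ (j ^ 2 + 1 : ℕ)
  /-- `G₁` is cyclic. -/
  cyclic₁ : IsCyclic G₁
  /-- `#G₁ = j² + 1`. -/
  card₁ : Nat.card G₁ = j ^ 2 + 1
  /-- `G₂` is cyclic. -/
  cyclic₂ : IsCyclic G₂
  /-- `#G₂ = j² + 1`. -/
  card₂ : Nat.card G₂ = j ^ 2 + 1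
  /-- `G₁ ∩ G₂ = 0`. -/
  disjoint : G₁ ⊓ G₂ = ⊥
  /-- **v5 (repaired)**: the DIMENSION-4 general position of the translates `τ_s(Θ)`, `s ∈ G₁ + G₂` — any FIVE pairwise-distinct
  translates disjoint, any FOUR with finite intersection (Lemma 9.3.1's conclusion one dimension up). v1–v4 had the threefold
  predicate `TranslatesInGeneralPosition` here (any four DISJOINT), unsatisfiable on a fourfold modulo `FourTranslatesMeet`
  (p767843). At `j = 1` only «`τ_0Θ ∩ τ_{g₁}Θ ∩ τ_{g₂}Θ ∩ τ_{g₁+g₂}Θ` finite» has content (`emptyClause_levelOne`).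
  [cite: Markman2025SecantWeil, §9.3 Lemma 9.3.1 (proof)] -/
  generalPosition : TranslatesInGeneralPositionN 4 𝒥.J Θ (sumSet G₁ G₂)

namespace GenusFourSecantDatum

variable (D : GenusFourSecantDatum)

/-- the level `d = j²` (`K = ℚ(√-j²) = ℚ(i)`). [cite: Markman2025SecantWeil, Ex. 8.2.3] -/
def d : ℕ := D.j ^ 2

/-- `m := (j²+1)·j`, so that the descended operator has `ψ_Y² = -m²`. [cite: Markman2025SecantWeil, §1.5 (footnote)] -/
def m : ℕ := (D.j ^ 2 + 1) * D.j

/-- `Θ` is ample. [cite: Markman2025SecantWeil, §1.5 (p. 7)] -/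
theorem isAmple : D.Θ.IsAmple := D.principal.isAmple

/-- `K(Θ) = 0`. [cite: Markman2025SecantWeil, §9.3 Lemma 9.3.3] -/
theorem KTheta_eq_bot : D.𝒥.J.KTheta D.Θ = ⊥ := D.principal.KTheta_eq_bot

/-- `j² + 1 ≠ 0`. [folklore] -/
theorem succ_ne_zero : D.j ^ 2 + 1 ≠ 0 := Nat.succ_ne_zero _

/-- **`P := J × Ĵ`** (dim `8`). [cite: Markman2025SecantWeil, §1.3 and §1.5 (p. 7)] -/
def P : AbelianVariety ℂ := D.𝒥.J.prod (D.𝒥.J.dualOf D.Θ D.isAmple)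

/-- **`φ := φ_d = η(√−d)`, `d = j²`**, on `J × Ĵ` (F4 `weilOperator`). [cite: Markman2025SecantWeil, §3.2] -/
def φ : D.P ⟶ D.P := weilOperator D.isAmple D.KTheta_eq_bot D.d

/-- **`Y := (J × Ĵ)/Ḡ`**, the genus-4 secant quotient (F4 `secantQuotient`). [cite: Markman2025SecantWeil, §1.5 (p. 7)] -/
def Y : AbelianVariety ℂ := secantQuotient D.𝒥.J D.isAmple D.G₁ D.G₂ D.succ_ne_zero D.G₁_le D.G₂_le

/-- **`q : J × Ĵ → Y`**, the quotient isogeny (F4 `secantQuotientMap`). [cite: Markman2025SecantWeil, §1.5 (p. 7)] -/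
def q : D.P ⟶ D.Y := secantQuotientMap D.𝒥.J D.isAmple D.G₁ D.G₂ D.succ_ne_zero D.G₁_le D.G₂_le

/-- **`Y₁ := J/G₁`**, the first quotient fourfold (Markman's `Y = X/G`). [cite: Markman2025SecantWeil, Question 8.2.4] [cite: MumfordAV1970, §7 Thm. 4 p. 72] -/
def Y₁ : AbelianVariety ℂ := D.𝒥.J.torsionQuot D.succ_ne_zero D.G₁ D.G₁_le

/-- **`Y₂ := J/G₂`**, the second quotient fourfold. [cite: Markman2025SecantWeil, Question 8.2.4] [cite: MumfordAV1970, §7 Thm. 4 p. 72] -/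
def Y₂ : AbelianVariety ℂ := D.𝒥.J.torsionQuot D.succ_ne_zero D.G₂ D.G₂_le

/-- `π₁ : J → J/G₁`. [cite: MumfordAV1970, §7 Thm. 4 p. 72] -/
def π₁ : D.𝒥.J ⟶ D.Y₁ := D.𝒥.J.torsionQuotHom D.succ_ne_zero D.G₁ D.G₁_le

/-- `π₂ : J → J/G₂`. [cite: MumfordAV1970, §7 Thm. 4 p. 72] -/
def π₂ : D.𝒥.J ⟶ D.Y₂ := D.𝒥.J.torsionQuotHom D.succ_ne_zero D.G₂ D.G₂_le

/-- `φ_d ≫ φ_d = −(d • 𝟙)`, `d = j²`. [cite: Markman2025SecantWeil, §3.2] -/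
theorem φ_comp_φ : D.φ ≫ D.φ = -((D.d : ℤ) • 𝟙 D.P) := weilOperator_comp_self D.isAmple D.KTheta_eq_bot D.d

/-- `q` is an isogeny. [cite: MumfordAV1970, §7 Thm. 4 p. 72] -/
theorem isIsogeny_q : IsIsogeny D.q := isIsogeny_secantQuotientMap D.𝒥.J D.isAmple D.G₁ D.G₂ D.succ_ne_zero D.G₁_le D.G₂_le

/-- `dim (J × Ĵ) = 8`. [cite: Markman2025SecantWeil, §1.5 (p. 7)] -/
theorem dim_P : D.P.dim = 8 := by
  rw [P, dim_prod, dim_dualOf, D.dim_J]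

/-- `dim Y = 2·4` (an abelian EIGHTFOLD). [cite: Markman2025SecantWeil, §1.5 (p. 7) and Ex. 8.2.5] -/
theorem dim_Y : D.Y.dim = 2 * 4 := by
  rw [Y, dim_secantQuotient D.𝒥.J D.isAmple D.G₁ D.G₂ D.succ_ne_zero D.G₁_le D.G₂_le (dim_prod _ _), D.dim_J]

/-- `dim J/G₁ = 4`. [cite: MumfordAV1970, §7 Application 3 (p. 63)] -/
theorem dim_Y₁ : D.Y₁.dim = 4 := by
  rw [Y₁, dim_torsionQuot, D.dim_J]

/-- `dim J/G₂ = 4`. [cite: MumfordAV1970, §7 Application 3 (p. 63)] -/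
theorem dim_Y₂ : D.Y₂.dim = 4 := by
  rw [Y₂, dim_torsionQuot, D.dim_J]

/-! ### v5 sanity of the repaired general-position field (sorry-free; no new vacuity at the rung) -/

/-- `#G₁G₂ ≤ 4` at `j = 1` (`#G₁ = #G₂ = 1² + 1 = 2`). [folklore] -/
theorem ncard_sumSet_le_four (hj : D.j = 1) : (sumSet D.G₁ D.G₂).ncard ≤ 4 := by
  have h₁ : Nat.card D.G₁ = 2 := by simpa [hj] using D.card₁
  have h₂ : Nat.card D.G₂ = 2 := by simpa [hj] using D.card₂
  have := ncard_sumSet_le D.G₁ D.G₂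
  rw [h₁, h₂] at this
  exact this

/-- `G₁G₂` is a finite set at `j = 1`. [folklore] -/
theorem sumSet_finite (hj : D.j = 1) : (sumSet D.G₁ D.G₂).Finite := by
  have h₁ : Nat.card D.G₁ = 2 := by simpa [hj] using D.card₁
  have h₂ : Nat.card D.G₂ = 2 := by simpa [hj] using D.card₂
  have e₁ : (D.G₁ : Set (D.𝒥.J.Points ℂ)).ncard = 2 := by rw [← Nat.card_coe_set_eq]; exact h₁
  have e₂ : (D.G₂ : Set (D.𝒥.J.Points ℂ)).ncard = 2 := by rw [← Nat.card_coe_set_eq]; exact h₂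
  have f₁ : (D.G₁ : Set (D.𝒥.J.Points ℂ)).Finite := Set.finite_of_ncard_ne_zero (by omega)
  have f₂ : (D.G₂ : Set (D.𝒥.J.Points ℂ)).Finite := Set.finite_of_ncard_ne_zero (by omega)
  rw [sumSet_eq_mul]
  exact f₁.mul f₂

/-- **At the rung `j = 1` the FIVE-clause of the repaired field is VACUOUS**: there is no injective `t : Fin 5 → G₁G₂` because
`#G₁G₂ ≤ 2·2 = 4`. Hence at `j = 1` the only content of `generalPosition` is its FOUR-clause — the finiteness of the single
intersection `τ_0Θ ∩ τ_{g₁}Θ ∩ τ_{g₂}Θ ∩ τ_{g₁+g₂}Θ`. [folklore] -/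
theorem emptyClause_levelOne (hj : D.j = 1) (t : Fin 5 → D.𝒥.J.Points ℂ) (hmem : ∀ i, t i ∈ sumSet D.G₁ D.G₂)
    (ht : Function.Injective t) : False :=
  no_five_injective_of_ncard_le_four (D.sumSet_finite hj) (D.ncard_sumSet_le_four hj) t hmem ht

/-- Hence at `j = 1` the five-clause of `generalPosition` HOLDS vacuously — the repaired field adds no condition there beyond its
four-clause. [folklore] -/
theorem fiveClause_levelOne (hj : D.j = 1) :
    ∀ s : Fin 5 → D.𝒥.J.Points ℂ, (∀ i, s i ∈ sumSet D.G₁ D.G₂) → Function.Injective s →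
      ⋂ i, thetaTranslate D.𝒥.J D.Θ (s i) = ∅ :=
  fun s hmem hs => (D.emptyClause_levelOne hj s hmem hs).elim

/-- **Modulo `FourTranslatesMeet` (p767842), any four translates of the datum's `Θ` MEET** (`dim J = 4`, `Θ` effective — a
Riemann theta divisor — and ample): so the repaired FOUR-clause asks finiteness of a NON-EMPTY set, never emptiness; the v1–v4
field asked these very intersections to be empty (the disprover's p767843). [cite: Hartshorne1977, I Thm. 7.2 and II Thm. 7.6]
[cite: MumfordAV1970, §6 Application 1 and §16] -/
theorem fourTranslates_nonempty (H : FourTranslatesMeet) (s₁ s₂ s₃ s₄ : D.𝒥.J.Points ℂ) :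
    (thetaTranslate D.𝒥.J D.Θ s₁ ∩ thetaTranslate D.𝒥.J D.Θ s₂ ∩ thetaTranslate D.𝒥.J D.Θ s₃ ∩
      thetaTranslate D.𝒥.J D.Θ s₄).Nonempty :=
  H D.𝒥.J D.Θ D.dim_J D.riemann.isEffective D.principal.isAmple s₁ s₂ s₃ s₄

/-- The same in the indexed form of the four-clause: `⋂ᵢ τ_{tᵢ}Θ ≠ ∅` for every `t : Fin 4 → J(ℂ)`, modulo `FourTranslatesMeet`.
[cite: MumfordAV1970, §6 Application 1 and §16] -/
theorem fourClause_nonempty (H : FourTranslatesMeet) (t : Fin 4 → D.𝒥.J.Points ℂ) :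
    (⋂ i, thetaTranslate D.𝒥.J D.Θ (t i)).Nonempty := by
  obtain ⟨x, hx⟩ := D.fourTranslates_nonempty H (t 0) (t 1) (t 2) (t 3)
  simp only [Set.mem_inter_iff] at hx
  obtain ⟨⟨⟨h0, h1⟩, h2⟩, h3⟩ := hx
  refine ⟨x, Set.mem_iInter.mpr fun i => ?_⟩
  fin_cases i
  exacts [h0, h1, h2, h3]

/-- **SECANT OBJECTS ON BOTH QUOTIENT FOURFOLDS** (the typed content of Question 8.2.4, asked for `G₁` and for `G₂`): a polarization
class `θ₀` of `Θ` and a secant twisted object at discriminant `d = j²` on `J/G₁` along `π₁` and on `J/G₂` along `π₂`.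
[cite: Markman2025SecantWeil, Ex. 8.2.3 and Question 8.2.4] -/
def HasSecantObjects (C : ChernCharacterBetti) (Adm : PerfectAdmissibility) : Prop :=
  ∃ θ₀ : complexBetti D.𝒥.J.X 2, D.𝒥.J.IsPolarizationClassOf D.Θ θ₀ ∧
    HasSecantTwistedObjectOn C Adm D.d D.𝒥.J D.Y₁ D.π₁ θ₀ ∧ HasSecantTwistedObjectOn C Adm D.d D.𝒥.J D.Y₂ D.π₂ θ₀

/-- **A TWISTED SEED ON THE SECANT-QUOTIENT EIGHTFOLD `Y` OF THE DATUM** — exactly the binders of `HasHyperbolicSeedOn 𝒪 4 (m²)`,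
`𝒪 = twistedReflexiveClass C Adm`, `m = (j²+1)j`, with the eightfold PINNED to `Y = (J × Ĵ)/Ḡ` and the Weil operator PINNED to a
descent `ψ_Y` of `(j²+1)·φ_{j²}` along `q` (`q ≫ ψ_Y = ((j²+1)·φ) ≫ q`, `ψ_Y ≫ ψ_Y = -(m² • 𝟙)`): a projective embedding `e`, a
rational `a ≠ 0`, hyperbolic (split) type for `h_K = m²·e^*a + ψ_Y^*e^*a`, a non-zero rational `w ∈ W_K = weilClassesOf Y ψ_Y 4 m²`,
and ONE `B`-twisted `Adm`-admissible perfect complex on `Y` with `κ₄ = q·h_K⁴ + w`, `κ_p = c_p·h_Kᵖ` (`HasSeedOn`). Markman's intended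
witness: the descent `E` of the secant-product object through Orlov's equivalence (survey Prop. 11.1, 11.5 at `n = 3`).
[cite: Markman2025SecantWeil, §1.5, §9.3 and Ex. 8.2.5] [cite: Markman2025SurveySecant, Prop. 11.1 and Prop. 11.5]
[cite: vanGeemen1994HodgeAV, 5.2–5.4] -/
def HasTwistedSeed (C : ChernCharacterBetti) (Adm : PerfectAdmissibility) : Prop :=
  ∃ (ψY : D.Y ⟶ D.Y) (e : ProjectiveEmbedding D.Y.X) (a : complexBetti (projectiveSpace e.n ℂ) 2)
    (w : complexBetti D.Y.X (2 * 4)),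
    D.q ≫ ψY = ((D.j ^ 2 + 1) • D.φ) ≫ D.q ∧ ψY ≫ ψY = -((D.m ^ 2) • 𝟙 D.Y) ∧ IsRationalClass a ∧ a ≠ 0 ∧
    IsHyperbolicWeilType D.Y ψY 4
      (((D.m ^ 2 : ℕ) : ℂ) • complexBetti.map e.ι 2 a + complexBetti.map ψY.hom.hom.hom 2 (complexBetti.map e.ι 2 a)) ∧
    w ∈ weilClassesOf D.Y ψY 4 (D.m ^ 2) ∧ IsRationalClass w ∧ w ≠ 0 ∧
    HasSeedOn (twistedReflexiveClass C Adm) 4 D.Y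
      (((D.m ^ 2 : ℕ) : ℂ) • complexBetti.map e.ι 2 a + complexBetti.map ψY.hom.hom.hom 2 (complexBetti.map e.ι 2 a)) w

/-- **Forgetting the pin**: a twisted seed on the datum's eightfold is a hyperbolic seed of class `twistedReflexiveClass C Adm` at level
`(4, m²)`. [cite: vanGeemen1994HodgeAV, 5.2–5.4] [cite: Bloch1972Semiregularity, Remark (7.5)] -/
theorem hasHyperbolicSeedOn_of_hasTwistedSeed {C : ChernCharacterBetti} {Adm : PerfectAdmissibility}
    (h : D.HasTwistedSeed C Adm) : HasHyperbolicSeedOn (twistedReflexiveClass C Adm) 4 (D.m ^ 2) := by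
  obtain ⟨ψY, e, a, w, -, hψ, ha, ha0, hhyp, hwW, hwr, hw0, hseed⟩ := h
  exact ⟨D.Y, ψY, e, a, w, D.dim_Y, hψ, ha, ha0, hhyp, hwW, hwr, hw0, hseed⟩

/-- `m = 2` at `j = 1` (`d = 1`, `|G| = 2`: Markman's first case, `ψ_Y² = -4`). [cite: Markman2025SecantWeil, §1.5 (footnote)] -/
theorem m_eq_two_of_j_eq_one (hj : D.j = 1) : D.m = 2 := by
  simp [m, hj]

end GenusFourSecantDatum

/-! ## §2b Degenerate product model for `generalPosition` (director R19.467 (m1)): the incidence skeleton, kernel-checked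

On `J₀ = E₁ × E₂ × E₃ × E₄` with the product principal polarisation `Θ₀ = ⋃ᵢ Dᵢ`, `Dᵢ = prᵢ⁻¹(oᵢ)`, a translate is
`τ_c(Θ₀) = {x | ∃ i, xᵢ = cᵢ}` (centre `c = o + s`). If the centres of the translates are COORDINATEWISE pairwise distinct
(`k ↦ c k i` injective for every `i`), pigeonhole gives: any `5` such translates have EMPTY common intersection (`5 > 4`
coordinates), and any `4` meet in the finitely many points `x_{σ} = (c_{σ⁻¹(i)})_i`, `σ ∈ S₄` (`4! = 24 = (Θ₀⁴)`). At `j = 1`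
the four translates by `G₁ + G₂ = {0, g₁, g₂, g₁ + g₂} ≅ V₄ ⊂ J₀[2]` are coordinatewise distinct as soon as `(g₁)ᵢ, (g₂)ᵢ` are
distinct non-zero points of `Eᵢ[2] ≅ (ℤ/2)²` for every `i` (toy instance `toyCentre` below, by `decide`); at level `j` one takes
`(g₁)ᵢ, (g₂)ᵢ` a basis of `Eᵢ[j² + 1] ≅ (ℤ/(j²+1))²`. WHAT IS AND IS NOT CHECKED HERE: the lemmas below are the point-set
combinatorics of coordinate unions in a `4`-fold product (sorry-free); the identifications `τ_s(Θ₀) = coordUnion (o + s)`, the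
openness of both clauses of `TranslatesInGeneralPositionN 4` in families, and «`(J₀, Θ₀, G₁, G₂)` lies in the closure of the
genus-4 Jacobian locus with level structure» (so the clauses hold for the Jacobian of a GENERAL smooth genus-4 curve with suitable
`Gᵢ ⊂ J[j²+1]`) are PROSE — the pattern of Markman's proof of Lemma 9.3.1 (chain of three elliptic curves, `3! = (Θ³)` points)
one dimension up — and are flagged «heuristic» in STUB 1. [cite: Markman2025SecantWeil, §9.3 Lemma 9.3.1 (proof) and Lemma 9.1.5]
[cite: MumfordAV1970, §16 (Riemann–Roch) and §17] -/

/-- The translate with centre `c` of the coordinate-union divisor of a product: `{x | ∃ i, x i = c i}`. [folklore] -/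
def coordUnion {ι : Type*} {E : ι → Type*} (c : ∀ i, E i) : Set (∀ i, E i) := {x | ∃ i, x i = c i}

/-- A point common to the translates with centres `c k` picks, for each `k`, a coordinate `f k` with `x (f k) = c k (f k)`, and
coordinatewise-distinct centres make `f` injective. [folklore] -/
theorem coordUnion_choice {ι : Type*} {E : ι → Type*} {m : ℕ} (c : Fin m → ∀ i, E i)
    (hc : ∀ i, Function.Injective fun k => c k i) {x : ∀ i, E i} (hx : x ∈ ⋂ k, coordUnion (c k)) :
    ∃ f : Fin m → ι, Function.Injective f ∧ ∀ k, x (f k) = c k (f k) := by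
  simp only [Set.mem_iInter, coordUnion, Set.mem_setOf_eq] at hx
  choose f hf using hx
  refine ⟨f, fun k k' hkk' => hc (f k) ?_, hf⟩
  have h1 := hf k
  have h2 := hf k'
  rw [← hkk'] at h2
  simp only
  rw [← h1, ← h2]

/-- **Pigeonhole, clause 1 of the model**: more translates than coordinates, coordinatewise-distinct centres ⇒ EMPTY common
intersection (`m = 5 > 4`). [folklore] -/
theorem coordUnion_iInter_eq_empty_of_card_lt {ι : Type*} [Fintype ι] {E : ι → Type*} {m : ℕ} (hm : Fintype.card ι < m)
    (c : Fin m → ∀ i, E i) (hc : ∀ i, Function.Injective fun k => c k i) : ⋂ k, coordUnion (c k) = ∅ := by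
  refine Set.eq_empty_iff_forall_notMem.mpr fun x hx => ?_
  obtain ⟨f, hf, -⟩ := coordUnion_choice c hc hx
  obtain ⟨k, k', hne, hkk'⟩ := Fintype.exists_ne_map_eq_of_card_lt f (by simpa using hm)
  exact hne (hf hkk')

/-- **Pigeonhole, clause 2 of the model**: as many translates as coordinates, coordinatewise-distinct centres ⇒ every common point
is `i ↦ c (g i) i` for some `g : ι → Fin m`, so the common intersection is FINITE (at most `4! = 24` points for `m = 4`; the
lemma records finiteness, which is what the field asks). [folklore] -/
theorem coordUnion_iInter_finite_of_card_eq {ι : Type*} [Fintype ι] {E : ι → Type*} {m : ℕ} (hm : Fintype.card ι = m)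
    (c : Fin m → ∀ i, E i) (hc : ∀ i, Function.Injective fun k => c k i) : (⋂ k, coordUnion (c k)).Finite := by
  refine (Set.finite_range fun g : ι → Fin m => fun i => c (g i) i).subset fun x hx => ?_
  obtain ⟨f, hf, hfx⟩ := coordUnion_choice c hc hx
  have e : Fin m ≃ ι := Fintype.equivOfCardEq (by simp [hm])
  have hsurj : Function.Surjective f := (Finite.injective_iff_surjective_of_equiv e).mp hf
  choose g hg using hsurj
  refine ⟨g, funext fun i => ?_⟩
  have := hfx (g i)
  rw [hg i] at this
  exact this.symm

/-- The `j = 1` toy centres in `(E[2])⁴`, `E[2]` modelled by `ZMod 2 × ZMod 2`: `0`, `g₁ = ((1,0))ᵢ`, `g₂ = ((0,1))ᵢ`, `g₁ + g₂`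
— the sum-set `G₁ + G₂ ≅ V₄`. [folklore] -/
def toyCentre : Fin 4 → Fin 4 → ZMod 2 × ZMod 2 :=
  fun k _ => match k with
    | 0 => (0, 0)
    | 1 => (1, 0)
    | 2 => (0, 1)
    | 3 => (1, 1)

/-- The toy centres are coordinatewise pairwise distinct (`decide`). [folklore] -/
theorem toyCentre_coord_injective : ∀ i : Fin 4, Function.Injective fun k => toyCentre k i := by
  intro i a b h
  revert a b i
  decide

/-- **The degenerate model at `j = 1`, clause 2**: the four `V₄`-translates of `Θ₀` meet in finitely many points. [folklore] -/
theorem toy_fourClause_finite : (⋂ k, coordUnion (toyCentre k)).Finite :=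
  coordUnion_iInter_finite_of_card_eq (by simp) toyCentre toyCentre_coord_injective

/-- **The degenerate model, clause 1 at higher level**: any five coordinatewise-distinct translates of `Θ₀` have empty common
intersection (at `j = 1` there are only four translates, so clause 1 is vacuous there — `GenusFourSecantDatum.fiveClause_levelOne`).
[folklore] -/
theorem model_fiveClause_empty {E : Fin 4 → Type*} (c : Fin 5 → ∀ i, E i) (hc : ∀ i, Function.Injective fun k => c k i) :
    ⋂ k, coordUnion (c k) = ∅ :=
  coordUnion_iInter_eq_empty_of_card_lt (by simp) c hc

/-! ## §3 The registered stubs -/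

/-- **STUB 1 — THE BC5 RUNG (plan-only): Markman's Question 8.2.4, typed, at `d = 1`.** For every Chern character theory `C`
there is a genus-4 secant–quotient datum at `j = 1` (`|Gᵢ| = 2`) whose two quotient fourfolds `J/G₁`, `J/G₂` each carry a
`B`-twisted `AdmTw'`-admissible perfect complex of non-zero rank with twisted classes on the secant plane of `exp(√-1·θ₀)`
(`HasSecantObjects`). Intended witness: `F̄′ = [𝒪_{J/G} → ν̄_*𝒪_{Z̃/G}]`, `Z` a `G`-invariant secant subscheme (`2` translates of
`W₂` and points), Ex. 8.2.3 / Question 8.2.4. Named technique: Lemma 8.3.4 (semiregularity criterion) via a Lemma 8.3.7-type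
computation of the Yoneda algebra, Cor. 8.5.4. WHY IT MIGHT FAIL: `dim Ext²(F_d, F_d) = 8d(d+1) − 2 + 2·dim Ext¹(F_d, F_d)` is
large (Ex. 8.2.3) and the `G`-invariant part of `Ext²(F′, F′)` may still exceed what σ can separate (`Σ_q h^{q,q+2}(J/G) = 28`);
`Ext^{<0}(F̄′, F̄′) = 0` and the tree's all-degrees σ (incl. `q = 0`) are part of `gluableSigmaAdmissible`. ON THE DATUM
(v5): the field `generalPosition` is `TranslatesInGeneralPositionN 4` (five translates EMPTY ∧ four FINITE) — v4's three-fold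
predicate (four translates empty) was unsatisfiable on a fourfold (`Negative/SecantTranslatesGeneralPosition.lean`); at `j = 1` its
five-clause is vacuous (`fiveClause_levelOne`) and its four-clause cannot be emptiness (`fourClause_nonempty`); that the four-clause
(finiteness) is MET by the Jacobian of a general smooth genus-4 curve with `Gᵢ ⊂ J[2]` is «heuristic»: degenerate product model
`E⁴` (kernel incidence skeleton §2b: `toy_fourClause_finite`, `model_fiveClause_empty`) + openness + closure of the Jacobian locus,
NOT a kernel statement about `thetaTranslate`.
[cite: Markman2025SecantWeil, Ex. 8.2.3, Question 8.2.4, Lemma 8.3.4, Lemma 8.3.7, Cor. 8.5.4 and §9.3 Lemma 9.3.1 (proof)] -/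
theorem stub_rung_secantObjectsQ824 :
    ∀ C : ChernCharacterBetti, ∃ D : GenusFourSecantDatum, D.j = 1 ∧ D.HasSecantObjects C AdmTwP := by
  sorry

/-- **STUB 2 — THE TRANSFER (`n = 4` analogue of Markman §9 / survey Prop. 11.1, 11.5).** For every `C` and every genus-4 datum `D`,
secant objects on both quotient fourfolds give ONE twisted admissible seed on the secant-quotient EIGHTFOLD `Y = (J × Ĵ)/Ḡ` for the
descended operator `ψ_Y` (`D.HasTwistedSeed`): Orlov's equivalence `Φ : D^b(J × Ĵ) ≃ D^b(J × J)` carries the secant product to an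
object whose `Ḡ`-descent `E` (μ_r-twisted when `gcd(rank, |Ḡ|) ≠ 1`, Lemma 9.3.6 — hosted by the `B`-twist) has twisted class
`κ(E) = exp(ℓ₁)·exp(ℓ₂/√-d)`-line (Lemma 7.4.2), semiregular by the derived invariance of the hypotheses of Lemma 8.3.4 (Rem. 8.3.6),
and whose `κ₄` has a non-zero component `w` in the Weil plane of `(Y, ψ_Y)` (split type: van Geemen 5.2–5.4). WHY IT MIGHT FAIL:
Markman transfers the CRITERION hypotheses (Lemma 8.3.4), not bare semiregularity — `HasSecantObjects` records only admissibility;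
at `n = 3` the untwisted descent wants `d` even (Rem. 9.3.7), here `d = j²`; «a similar extension should be possible for the
sheaf in Question 8.2.4» (Ex. 8.2.5) is unproved in print; at the rung of record `j = 1` one has d = 1 < 3 — outside the proved
range `d ≥ 3` of Assumption 9.1.1 / Lemmas 9.1.2, 9.1.4 (reducedness of the secant scheme and the chain argument), so even the
genus-3 template is not in print at this level (declared fallback rung: `j = 2`, `d = 4`, `|Gᵢ| = 5`, `m = 10`, `25` translates).
CONSUMER HONESTY (director R19.467 (m2)): in genus 3, Markman §9.2 (Assumption 9.2.1 (1), Prop. 9.2.2) consumes four-fold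
EMPTINESS and three-fold finiteness of the surfaces `Θ_{i,j} = Σ_j − C_i` (translates of `Θ`) to make `Θ̃ = ⋃ Θ̃_{i,j}` smooth and
`𝒢₁` locally free off it; the `n = 4` consumer of `generalPosition` (five-fold emptiness ∧ four-fold finiteness on the fourfold `J`)
is NOT in print and is part of THIS stub's open content. [cite: Markman2025SecantWeil, Ex. 8.2.5, Lemma 7.4.2, Rem. 8.3.6,
§9.1 Assumption 9.1.1, Lemma 9.1.2 and Lemma 9.1.4, §9.2 Assumption 9.2.1 and Prop. 9.2.2, §9.3 Lemma 9.3.6 and Rem. 9.3.7]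
[cite: Markman2025SurveySecant, Prop. 11.1, Prop. 11.5 and Question 11.4] [cite: vanGeemen1994HodgeAV, 5.2–5.4] -/
theorem stub_transfer_secantQuotientEightfold :
    ∀ (C : ChernCharacterBetti) (D : GenusFourSecantDatum), D.HasSecantObjects C AdmTwP → D.HasTwistedSeed C AdmTwP := by
  sorry

/-! ## §4 The kernel-checked composition (lint shape: ONE hypothesis-free theorem concludes the crux) -/

/-- **THE PINNED FORM OF THE CRUX** (shape of №3's accepted plan-only rung `stub_rung_pad4_seedAt`): for every `C`, a twisted seed on
the secant-quotient eightfold of SOME genus-4 datum at `j = 1` (`ψ_Y² = -4`). [cite: Markman2025SecantWeil, Ex. 8.2.5] -/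
def GenusFourSecantSeed : Prop :=
  ∀ C : ChernCharacterBetti, ∃ D : GenusFourSecantDatum, D.j = 1 ∧ D.HasTwistedSeed C AdmTwP

/-- **GLUE 1 — STUB 1 statement → STUB 2 statement → the pinned form** (rung + transfer; the stub STATEMENTS as hypotheses; conclusion
head `GenusFourSecantSeed`, not the crux, so the skeleton lint does not read it as the skeleton theorem). [cite: Markman2025SecantWeil, Ex. 8.2.5] -/
theorem genusFourSecantSeed_of
    (hQ : ∀ C : ChernCharacterBetti, ∃ D : GenusFourSecantDatum, D.j = 1 ∧ D.HasSecantObjects C AdmTwP)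
    (hT : ∀ (C : ChernCharacterBetti) (D : GenusFourSecantDatum), D.HasSecantObjects C AdmTwP → D.HasTwistedSeed C AdmTwP) :
    GenusFourSecantSeed := fun C => by
  obtain ⟨D, hj, hD⟩ := hQ C
  exact ⟨D, hj, hT C D hD⟩

/-- **GLUE 2 — the pinned form ⟹ the level-`(4, 2²)` twisted seed for every `C`** (forget the pin: `dim Y = 2·4`, `m = (1+1)·1 = 2`).
Conclusion head `HasHyperbolicSeedOn`, not the crux. [cite: vanGeemen1994HodgeAV, 5.2–5.4] -/
theorem hasHyperbolicSeedOn_four_four_of_genusFourSecantSeed (h : GenusFourSecantSeed) (C : ChernCharacterBetti) :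
    HasHyperbolicSeedOn (twistedReflexiveClass C AdmTwP) 4 (2 ^ 2) := by
  obtain ⟨D, hj, hD⟩ := h C
  have hS := D.hasHyperbolicSeedOn_of_hasTwistedSeed hD
  rw [D.m_eq_two_of_j_eq_one hj] at hS
  exact hS

/-- **THE SKELETON THEOREM `SheafSeedGaussSq_of` (BC3) — STUB 1, STUB 2 ⟹ the crux BY NAME with `m := 2`; HYPOTHESIS-FREE** (it invokes
the two registered `stub_*` theorems, exactly as №3's `BlochSeedDiscOne_of_pad4` does; this is the ONLY declaration of this file whose
conclusion is `Summit.HodgeConjecture.HodgeConjecture.Theses.EightfoldTwistedSheafSeeds.SheafSeedGaussSq`). No `sorry` in this declaration;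
its axiom closure contains `sorryAx` through the stubs until they are proved (`closed = false`). -/
theorem SheafSeedGaussSq_of :
    Summit.HodgeConjecture.HodgeConjecture.Theses.EightfoldTwistedSheafSeeds.SheafSeedGaussSq :=
  ⟨2, two_pos, fun C =>
    hasHyperbolicSeedOn_four_four_of_genusFourSecantSeed
      (genusFourSecantSeed_of stub_rung_secantObjectsQ824 stub_transfer_secantQuotientEightfold) C⟩

/-! ## §5 Sanity of the secant-plane coefficients (`d = 1`: `1 + θ − θ²/2 − θ³/6 + θ⁴/24`) -/

example : secRe 1 0 = 1 ∧ secIm 1 1 = 1 ∧ secRe 1 2 = -1 / 2 ∧ secIm 1 3 = -1 / 6 ∧ secRe 1 4 = 1 / 24 := by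
  simp only [secRe, secIm, Nat.factorial]
  norm_num [Nat.even_iff]

example : secIm 1 0 = 0 ∧ secRe 1 1 = 0 ∧ secIm 1 2 = 0 ∧ secRe 1 3 = 0 ∧ secIm 1 4 = 0 := by
  simp only [secRe, secIm]
  norm_num [Nat.even_iff]

end Summit.HodgeConjecture.HodgeConjecture.Cruxes.SheafSeedGaussSq.SecantQ824
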